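import Summits.CriticalPhenomena.PercolationContinuityZ3.Theorems.Transplant.GrigorchukPowerNcHaraSladeLaceNormExchangeable
import HarnessLib

/-!
# W4 — `Cay(𝔊^k; std)` is the box power of `Cay(𝔊; a,b,c,d)`: `dist(1, x) = Σ_i dist_𝔊(1, x_i)`, and (4′) in graph-distance form

Proof file (`--supports stmt-CriticalPhenomena-4575 --as helper`), lane `prim-bschramm`, seat `prim-bschramm-gen-1` gen 12 (GEN pen); small S add-on to «…LaceNormExchangeable»
(refuter note N-p5g35-1 wrote `dist(1,x) = Σ_i dist_𝔊(1,x_i)` as the box length; here it is proved, so that (4′) reads with the graph distance of `Cay(𝔊^k)` itself).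
builds on p205010 (kernel theorem, internal audit signed; external expert review pending) — nothing here uses p205010.  Def-free; no instance, no notation, no sorry; stakes no claim.

* `mulSingleHom i : stdCay →g gkCay k` is NOT defined (def-free file): walks are pushed into coordinate `i` inline.  `gkCay_dist_le_sum` (a walk coordinate by coordinate),
  `sum_dist_le_length` (every edge of `Cay(𝔊^k)` moves one coordinate by one letter), **`gkCay_dist_eq_sum : (gkCay k).dist 1 x = Σ_i stdCay.dist 1 (x i)`**, and
  **`laceNormE_le_of_exchangeable_dist`**: (4′) with `n(x) = dist_{Cay(𝔊^k)}(1, x)`.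
[cite: BenjaminiSchramm1996, §2 (Cayley graphs)] [cite: HeydenreichVanDerHofstad2017, §8.3]
-/

noncomputable section

namespace Summit.CriticalPhenomena.PercolationContinuityZ3.Theorems.Transplant

namespace Grigorchuk

namespace NcHaraSlade

open SimpleGraph Finset Literature.Probability.Percolation
open scoped ENNReal Classical

variable {k : ℕ}

/-- A `Cay(𝔊; a,b,c,d)`-walk placed in coordinate `i` and translated by `u`: a `Cay(𝔊^k)`-walk `u·mulSingle i g → u·mulSingle i h` of the same length. [folklore] -/
theorem exists_walk_mulSingle (u : GPow k) (i : Fin k) {g h : ↥grigorchukGroup} (w : stdCay.Walk g h) :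
    ∃ w' : (gkCay k).Walk (u * Pi.mulSingle i g) (u * Pi.mulSingle i h), w'.length = w.length := by
  induction w with
  | nil => exact ⟨Walk.nil, rfl⟩
  | @cons a b c hab _ ih =>
    obtain ⟨w', hw'⟩ := ih
    obtain ⟨y, hy⟩ := stdCay_adj_iff.1 hab
    have hadj : (gkCay k).Adj (u * Pi.mulSingle i a) (u * Pi.mulSingle i b) :=
      gkCay_adj_iff.2 ⟨i, y, by rw [hy, Pi.mulSingle_mul, mul_assoc]⟩
    exact ⟨Walk.cons hadj w', by rw [Walk.length_cons, Walk.length_cons, hw']⟩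

/-- **`dist_{Cay(𝔊^k)}(1, x) ≤ Σ_i dist_𝔊(1, x_i)`** (walk coordinate by coordinate). [cite: BenjaminiSchramm1996, §2 (Cayley graphs)] -/
theorem gkCay_dist_le_sum (x : GPow k) : (gkCay k).dist 1 x ≤ ∑ i, stdCay.dist 1 (x i) := by
  have hconn : stdCay.Connected := CayleyScaled.connected_mulCayley_of_closure _ closure_gens_finset
  -- by induction on the support: a walk `1 → x` of length `Σ_{i∈T} dist(1, x_i)` for `x` supported in `T`
  suffices h : ∀ T : Finset (Fin k), ∀ x : GPow k, (∀ i, i ∉ T → x i = 1) →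
      ∃ w : (gkCay k).Walk 1 x, w.length = ∑ i ∈ T, stdCay.dist 1 (x i) by
    obtain ⟨w, hw⟩ := h Finset.univ x fun i hi => absurd (Finset.mem_univ i) hi
    exact (dist_le w).trans hw.le
  intro T
  induction T using Finset.induction_on with
  | empty =>
    intro x hx
    have hx1 : x = 1 := funext fun i => hx i (Finset.notMem_empty i)
    subst hx1
    exact ⟨Walk.nil, by simp⟩
  | insert i T hiT ih =>
    intro x hx
    set x' : GPow k := Function.update x i 1 with hx'
    have hx'T : ∀ j, j ∉ T → x' j = 1 := by
      intro j hj
      by_cases hji : j = i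
      · rw [hji, hx', Function.update_self]
      · rw [hx', Function.update_of_ne hji]
        exact hx j (by rw [Finset.mem_insert]; exact not_or.2 ⟨hji, hj⟩)
    have hxeq : x' * Pi.mulSingle i (x i) = x := by
      funext j
      by_cases hji : j = i
      · rw [hji, Pi.mul_apply, hx', Function.update_self, Pi.mulSingle_eq_same, one_mul]
      · rw [Pi.mul_apply, hx', Function.update_of_ne hji, Pi.mulSingle_eq_of_ne hji, mul_one]
    have hx'j : ∀ j ∈ T, x' j = x j := fun j hj => by
      have hji : j ≠ i := fun h => hiT (h ▸ hj)
      rw [hx', Function.update_of_ne hji]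
    obtain ⟨w₁, hw₁⟩ := ih x' hx'T
    obtain ⟨w₀, hw₀⟩ := hconn.exists_walk_length_eq_dist 1 (x i)
    obtain ⟨w₂, hw₂⟩ := exists_walk_mulSingle x' i w₀
    have e1 : x' * Pi.mulSingle i (1 : ↥grigorchukGroup) = x' := by rw [Pi.mulSingle_one, mul_one]
    refine ⟨w₁.append (w₂.copy e1 hxeq), ?_⟩
    rw [Walk.length_append, Walk.length_copy, hw₁, hw₂, hw₀, Finset.sum_insert hiT,
      Finset.sum_congr rfl fun j hj => by rw [hx'j j hj], add_comm]

/-- **`Σ_i dist_𝔊(u_i, v_i) ≤ |w|`** for every `Cay(𝔊^k)`-walk `w : u → v`: each edge moves exactly one coordinate, by one letter. [cite: BenjaminiSchramm1996, §2] -/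
theorem sum_dist_le_length {u v : GPow k} (w : (gkCay k).Walk u v) : ∑ i, stdCay.dist (u i) (v i) ≤ w.length := by
  have hconn : stdCay.Connected := CayleyScaled.connected_mulCayley_of_closure _ closure_gens_finset
  induction w with
  | nil => simp
  | @cons a b c hab _ ih =>
    obtain ⟨j, y, hj⟩ := gkCay_adj_iff.1 hab
    rw [Walk.length_cons]
    -- `Σ_i d(a_i, c_i) ≤ Σ_i d(a_i, b_i) + Σ_i d(b_i, c_i)` and `Σ_i d(a_i, b_i) = 1`
    have htri : ∑ i, stdCay.dist (a i) (c i) ≤ ∑ i, stdCay.dist (a i) (b i) + ∑ i, stdCay.dist (b i) (c i) := by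
      rw [← Finset.sum_add_distrib]
      exact Finset.sum_le_sum fun i _ => hconn.dist_triangle
    have hone : ∑ i, stdCay.dist (a i) (b i) = 1 := by
      rw [Finset.sum_eq_single j, hj, Pi.mul_apply, Pi.mulSingle_eq_same]
      · exact dist_eq_one_iff_adj.2 (stdCay_adj_iff.2 ⟨y, rfl⟩)
      · intro i _ hij
        rw [hj, Pi.mul_apply, Pi.mulSingle_eq_of_ne hij, mul_one, dist_self]
      · exact fun h => absurd (Finset.mem_univ j) h
    omega

/-- **`Cay(𝔊^k; std)` is the box power of `Cay(𝔊; a,b,c,d)`: `dist(1, x) = Σ_i dist_𝔊(1, x_i)`.** [cite: BenjaminiSchramm1996, §2 (Cayley graphs)] -/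
theorem gkCay_dist_eq_sum (x : GPow k) : (gkCay k).dist 1 x = ∑ i, stdCay.dist 1 (x i) := by
  refine le_antisymm (gkCay_dist_le_sum x) ?_
  obtain ⟨w, hw⟩ := (gkCay_connected k).exists_walk_length_eq_dist 1 x
  have h := sum_dist_le_length w
  simp only [Pi.one_apply] at h
  rwa [hw] at h

/-- **(4′) with the graph distance of `Cay(𝔊^k)`: `laceNormE k K ≤ ‖K‖₁ ⊔ 4 · Σ_x |K(x)| dist(1,x)²` for coordinate-exchangeable `K`** (no factor `k`).
Refuter note N-p5g35-1. [cite: HeydenreichVanDerHofstad2017, Prop. 8.3] -/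
theorem laceNormE_le_of_exchangeable_dist (hk : 1 ≤ k) {K : GPow k → ℝ} (hK : ∀ σ : Equiv.Perm (Fin k), ∀ x : GPow k, K (x ∘ σ) = K x)
    (h2 : Summable fun x => |K x| * ((gkCay k).dist 1 x : ℝ) ^ 2) :
    laceNormE k K ≤ (∑' x, ENNReal.ofReal |K x|) ⊔ ENNReal.ofReal (4 * ∑' x, |K x| * ((gkCay k).dist 1 x : ℝ) ^ 2) := by
  have hcast : ∀ x : GPow k, ((gkCay k).dist 1 x : ℝ) = ∑ i, (stdCay.dist 1 (x i) : ℝ) := fun x => by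
    rw [gkCay_dist_eq_sum]; push_cast; rfl
  simp only [hcast] at h2 ⊢
  exact laceNormE_le_of_exchangeable hk hK h2

end NcHaraSlade

end Grigorchuk

end Summit.CriticalPhenomena.PercolationContinuityZ3.Theorems.Transplant

end
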